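import Summits.Langlands.Langlands.Theorems.SkinnerWilesDefectOneBianchiCongruenceCohomologyFinite

/-!
# Route SkinnerWilesDefectOne — `Assembly2` (item stmt-Langlands-15711)

The item `Assembly2` of route `SkinnerWilesDefectOne` for the Langlands summit is, verbatim up
to the order of the two field hypotheses (`IsTotallyComplex K`, `finrank ℚ K = 2`), the crux
`BianchiCongruenceCohomologyFinite` (stmt-Langlands-15362; the planner re-filed the statement
under that name after the gate rendered this item as `Assembly2`): for `K` imaginary quadratic,
`U ≤ GL₂(𝔸_K^∞)` compact open, `Γ_U = GL₂(K) ∩ U` and `A` a FINITE `ℤ[Γ_U]`-module, every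
`H^q(Γ_U, A)` is finite.  It follows at once from the landed theorem
`Summit.Langlands.Langlands.Theorems.BianchiCongruenceCohomologyFinite_proof`
(`SkinnerWilesDefectOneBianchiCongruenceCohomologyFinite`) by swapping the two hypotheses.
-/

namespace Summit.Langlands.Langlands.Theses.SkinnerWilesDefectOne
/-- **Record of the dropped route item `Assembly2`** = stmt-Langlands-15711 (ledger signature verbatim; NOT a route
item): route SkinnerWilesDefectOne (2026-08-17T16:48Z) dropped the proved `Assembly2`. The declaration `Summit.Langlands.Langlands.Theses.SkinnerWilesDefectOne.Assembly2`
therefore no longer exists in the route file and this accepted module stopped elaborating (stale olean;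
buildfix lane 2026-08-19). Re-created here under its original name so the result keeps building; the
statement of every previously accepted declaration in this file is unchanged. -/
def Assembly2 : Prop :=
  ∀ (K : Type) [Field K] [NumberField K], NumberField.IsTotallyComplex K → Module.finrank ℚ K = 2 → ∀ (U : Subgroup (Literature.NumberTheory.Automorphic.BigHeckeGLn.FiniteAdelicGL 2 K)), IsOpen (U : Set (Literature.NumberTheory.Automorphic.BigHeckeGLn.FiniteAdelicGL 2 K)) → IsCompact (U : Set (Literature.NumberTheory.Automorphic.BigHeckeGLn.FiniteAdelicGL 2 K)) → ∀ (A : Rep ℤ (U.comap (Literature.NumberTheory.Automorphic.BigHeckeGLn.globalEmbedding 2 K))), Finite A → ∀ q : ℕ, Finite (groupCohomology A q)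
end Summit.Langlands.Langlands.Theses.SkinnerWilesDefectOne


set_option linter.dupNamespace false -- project-wide option (lakefile weak.linter.dupNamespace); `Summit.Langlands.Langlands` is the mandated namespace

namespace Summit.Langlands.Langlands.Theorems

/-- **Borel–Serre finiteness for Bianchi congruence subgroups** (item `Assembly2`,
stmt-Langlands-15711): for `K` imaginary quadratic, `U ≤ GL₂(𝔸_K^∞)` compact open and `A` a finite
`ℤ[Γ_U]`-module, `H^q(Γ_U, A)` is finite for every `q`.  Proof: unfold, swap the hypotheses
`IsTotallyComplex K` and `finrank ℚ K = 2`, and apply `BianchiCongruenceCohomologyFinite_proof`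
(item stmt-Langlands-15362, the same statement). [cite: BorelSerre1973, §11.1, Thm. 11.4.4] -/
theorem assembly2_proof : Summit.Langlands.Langlands.Theses.SkinnerWilesDefectOne.Assembly2 := by
  unfold Summit.Langlands.Langlands.Theses.SkinnerWilesDefectOne.Assembly2
  intro K _ _ hK h2 U hUo hUc A hA q
  have h := BianchiCongruenceCohomologyFinite_proof
  unfold Summit.Langlands.Langlands.Theses.SkinnerWilesDefectOne.BianchiCongruenceCohomologyFinite at h
  exact h K h2 hK U hUo hUc A hA q

end Summit.Langlands.Langlands.Theorems
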